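import Summits.QuantumFields.YangMills.Theorems.UnitScaleTiltProp7CornerFrameLegsFlatZd
import HarnessLib

/-!
# Route `UnitScaleTilt`, crux K1 (stmt-QuantumFields-19200), LANE II (QB) ∕ (R-LEGS): THE ℤ³ CORE, PART 2 — the flat corner-frame legs are K-UNIFORM:
# `‖Σ_{j<k} [F̂(Lᵏ⁻ʲy)[Q_j(1)A] − F̂(Lᵏ⁻ʲ(y+e_μ))[Q_j(1)A]]‖² ≤ 2C₂(L,N)·Lᵏ∕(L−2)·Σ_κ GradE_{A(·,κ)}(box(Lᵏy, 2L^{k+2}))` (no log)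
Cell `ym3-torus`, width seat `ym3-torus-px19` (gen 6; pen (R-LEGS)).  THEOREMS ONLY (0 `def`, 0 `sorry`); `--supports stmt-QuantumFields-19200 --as helper`, count-neutral.
YM₃ on T³ is a ladder rung (R3), not d = 4, not Clay; nothing here claims a stub, the crux or the gap.  Part 1 = ✓`…CornerFrameLegsFlatZd`, letters = ✓p709214.  The member
reading (`X♯`, `coordT3`, torus sums — `rlegs_flat`'s text) is the next file.
PROVED (ns `…Prop7CornerFrameLegsFlatZdLevels`; `A : ℤ³ → Fin 3 → M_N` arbitrary, `3 ≤ L`): §1 `asum_translate`, `Fhat_translate`, `box_subset_box_of`; §2 ★`normSq_tubeAvg_sub_topMean_le`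
(one level-`j` tube against the mean of a top box `box(c_T,2L^{t+1}) ⊇ box(Lʲx,2Lᵗ)`: `≤ C₁·L^{−j}·GradE(T)`, `C₁ = 3(10N + (5NL²∕32)(L∕(√L−1)² + 1))`); §3 ★`normSq_Fhat_linQIter_sub_le`
(per level: `≤ 9L²(6L+1)³·4·C₁·Lʲ·Σ_κ GradE(T)`); §4 `tubeBox_subset_top`, ★★`normSq_cornerFrameLegs_flat_Zd` (dyadic level sum, ★px6 ✓`norm_sq_sum_range_le_two_mul_dyadic` ∘
✓`dyadic_level_sum_le`).  HONEST SCOPE: lattice bookkeeping; no YM content.  Numerics (kit j327115∕j327771; px22 j328060): K-uniform through k = 4 at L = 3.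
References: T. Bałaban, CMP 98 (1985) 17–51 [Balaban1985Averaging] ((110)–(112), (122)–(127), (160)); M. Giaquinta (1983) [Giaquinta1984] Ch. III §1.
-/

set_option autoImplicit false

noncomputable section

open scoped BigOperators Matrix.Norms.L2Operator
open Finset

namespace Summit.QuantumFields.YangMills.Theorems.Prop7CornerFrameLegsFlatZdLevels

open Literature.MathematicalPhysics.QuantumFieldTheory.Balaban1983to89
open Literature.MathematicalPhysics.QuantumFieldTheory.Balaban1983to89.B4Eq19LatticeOperators (Zd box unitVec mem_box)
open B7Prop1Explicit (asum stepA treeWord boxVec l1 e asum_cons asum_nil)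
open B7Prop3Flat (Fhat)
open B7Prop4Flat (linQIter)
open Summit.QuantumFields.YangMills.Theorems.Prop7LatticeBoxPoincareCov (card_box_eq)
open Summit.QuantumFields.YangMills.Theorems.Prop7SliceBoundBookkeeping (norm_sq_sum_range_le_two_mul_dyadic dyadic_level_sum_le geom_sum_range_inv_le norm_sq_sum_le_card_mul)
open Summit.QuantumFields.YangMills.Theorems.Prop7CornerTreeTubeLetters (normSq_Fhat_le Fhat_sub normSq_boxMean_sub_boxMean_le)
open Summit.QuantumFields.YangMills.Theorems.Prop7CornerFrameLegsFlatZd (linQIter_eq_smul_avg normSq_tubeAvg_sub_boxMean_le gradE_mono box_subset_box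
  normSq_boxMean_step_le norm_boxMean_chain_le two_mul_pow_le_succ)

variable {N : ℕ}

/-! ## §1 Translation of the tree functional; boxes under the triangle inequality -/

/-- `asum (A∘τ_v) x w = asum A (x+v) w`. [folklore] -/
theorem asum_translate (A : Zd 3 → Fin 3 → Matrix (Fin N) (Fin N) ℂ) (v : Zd 3) :
    ∀ (w : List (B7Prop1Explicit.Letter 3)) (x : Zd 3), asum (fun y κ => A (y + v) κ) x w = asum A (x + v) w
  | [], x => by simp
  | l :: w, x => by
    rw [asum_cons, asum_cons, asum_translate A v w (x + l.vec), add_right_comm x l.vec v]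
    congr 1
    unfold stepA
    split_ifs
    · rfl
    · rw [add_right_comm]

/-- `F̂(A∘τ_v)(q) = F̂(A)(q+v)`. [cite: Balaban1985Averaging, (110) p.34] -/
theorem Fhat_translate (L : ℕ) (A : Zd 3 → Fin 3 → Matrix (Fin N) (Fin N) ℂ) (v q : Zd 3) :
    Fhat L (fun y κ => A (y + v) κ) q = Fhat L A (q + v) := by
  unfold Fhat
  exact Finset.sum_congr rfl fun r _ => by rw [asum_translate]

/-- Boxes under the triangle inequality: `|c₁ − c₂|_∞ + R₁ ≤ R₂ ⟹ box c₁ R₁ ⊆ box c₂ R₂`. [folklore] -/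
theorem box_subset_box_of {c₁ c₂ : Zd 3} {R₁ R₂ : ℤ} (h : ∀ i, |c₁ i - c₂ i| + R₁ ≤ R₂) : box c₁ R₁ ⊆ box c₂ R₂ := by
  intro y hy
  rw [mem_box] at hy ⊢
  intro i
  have h1 := hy i
  have h2 := h i
  have h3 : |y i - c₂ i| ≤ |y i - c₁ i| + |c₁ i - c₂ i| := by
    have := abs_sub_le (y i) (c₁ i) (c₂ i); exact this
  linarith

/-! ## §2 One tube against a common top mean -/

/-- the geometric tail `Σ_{i∈[j,t)} (√L)^{−i} ≤ (√L)^{−j}·√L∕(√L−1)`. [folklore] -/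
theorem sum_Ico_sqrt_inv_pow_le (L : ℕ) (hL : 3 ≤ L) (j t : ℕ) :
    ∑ i ∈ Finset.Ico j t, ((Real.sqrt L)⁻¹) ^ i ≤ ((Real.sqrt L)⁻¹) ^ j * (Real.sqrt L / (Real.sqrt L - 1)) := by
  have hL1 : (1 : ℝ) < Real.sqrt L := by
    rw [show (1 : ℝ) = Real.sqrt 1 by simp]
    exact Real.sqrt_lt_sqrt (by norm_num) (by exact_mod_cast (by omega : 1 < L))
  rcases le_or_gt j t with hjt | hjt
  · rw [Finset.sum_Ico_eq_sum_range]
    simp_rw [pow_add, ← Finset.mul_sum]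
    exact mul_le_mul_of_nonneg_left (geom_sum_range_inv_le hL1 _) (by positivity)
  · rw [Finset.Ico_eq_empty (by omega), Finset.sum_empty]
    have : 0 < Real.sqrt L - 1 := by linarith
    positivity

set_option maxHeartbeats 400000 in
-- HEARTBEAT rule (README): three long box-mean terms and a triangle chain; measured > 200k; decl-local.
/-- ★ **ONE TUBE AGAINST A COMMON TOP MEAN**: `3 ≤ L`, `j ≤ t`, top box `T = box(c_T, 2L^{t+1}) ⊇ box(Lʲx, 2Lᵗ)`:
`‖Tub_j(x,κ) − mean_T A(·,κ)‖² ≤ C₁·L^{−j}·GradE_{A(·,κ)}(T)`, `C₁ = 3(10N + (5NL²∕32)(L∕(√L−1)² + 1))`. [cite: Balaban1985Averaging, (122)–(127) pp.36–37; Giaquinta1984, Ch. III §1] -/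
theorem normSq_tubeAvg_sub_topMean_le [NeZero N] (L : ℕ) (hL : 3 ≤ L) (F : Zd 3 → Matrix (Fin N) (Fin N) ℂ) (j t : ℕ) (hjt : j ≤ t)
    (x cT : Zd 3) (κ : Fin 3) (hT : box ((((L ^ j : ℕ) : ℤ)) • x) (2 * ((L ^ t : ℕ) : ℤ)) ⊆ box cT (2 * ((L ^ (t + 1) : ℕ) : ℤ))) :
    ‖((Fintype.card ((Fin 3 → Fin (L ^ j)) × Fin (L ^ j)) : ℝ)⁻¹)
          • ∑ σ : (Fin 3 → Fin (L ^ j)) × Fin (L ^ j), F ((((L ^ j : ℕ) : ℤ)) • x + boxVec (L ^ j) σ.1 + ((σ.2 : ℕ) : ℤ) • e κ)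
        - ((((box cT (2 * ((L ^ (t + 1) : ℕ) : ℤ))).card : ℝ) : ℂ))⁻¹ • ∑ y ∈ box cT (2 * ((L ^ (t + 1) : ℕ) : ℤ)), F y‖ ^ 2
      ≤ (3 * (10 * N + (5 * N * (L : ℝ) ^ 2 / 32) * ((L : ℝ) / (Real.sqrt L - 1) ^ 2 + 1))) * ((L : ℝ) ^ j)⁻¹
          * ∑ y ∈ box cT (2 * ((L ^ (t + 1) : ℕ) : ℤ)), ∑ ν,
              (if y + unitVec ν ∈ box cT (2 * ((L ^ (t + 1) : ℕ) : ℤ)) then ‖F (y + unitVec ν) - F y‖ ^ 2 else 0) := by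
  have hL1 : 1 ≤ L := by omega
  have hL0 : (0 : ℝ) < L := by exact_mod_cast (by omega : 0 < L)
  have hLj : (0 : ℝ) < (L : ℝ) ^ j := by positivity
  have hsL1 : (1 : ℝ) < Real.sqrt L := by
    rw [show (1 : ℝ) = Real.sqrt 1 by simp]
    exact Real.sqrt_lt_sqrt (by norm_num) (by exact_mod_cast (by omega : 1 < L))
  have hsL0 : 0 < Real.sqrt L - 1 := by linarith
  -- the four means
  obtain ⟨m0, hm0⟩ : ∃ m, m = ((Fintype.card ((Fin 3 → Fin (L ^ j)) × Fin (L ^ j)) : ℝ)⁻¹)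
          • ∑ σ : (Fin 3 → Fin (L ^ j)) × Fin (L ^ j), F ((((L ^ j : ℕ) : ℤ)) • x + boxVec (L ^ j) σ.1 + ((σ.2 : ℕ) : ℤ) • e κ) := ⟨_, rfl⟩
  obtain ⟨m1, hm1⟩ : ∃ m, m = ((((box ((((L ^ j : ℕ) : ℤ)) • x) (2 * ((L ^ j : ℕ) : ℤ))).card : ℝ) : ℂ))⁻¹
          • ∑ y ∈ box ((((L ^ j : ℕ) : ℤ)) • x) (2 * ((L ^ j : ℕ) : ℤ)), F y := ⟨_, rfl⟩
  obtain ⟨m2, hm2⟩ : ∃ m, m = ((((box ((((L ^ j : ℕ) : ℤ)) • x) (2 * ((L ^ t : ℕ) : ℤ))).card : ℝ) : ℂ))⁻¹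
          • ∑ y ∈ box ((((L ^ j : ℕ) : ℤ)) • x) (2 * ((L ^ t : ℕ) : ℤ)), F y := ⟨_, rfl⟩
  obtain ⟨mT, hmT⟩ : ∃ m, m = ((((box cT (2 * ((L ^ (t + 1) : ℕ) : ℤ))).card : ℝ) : ℂ))⁻¹ • ∑ y ∈ box cT (2 * ((L ^ (t + 1) : ℕ) : ℤ)), F y := ⟨_, rfl⟩
  obtain ⟨ET, hET⟩ : ∃ E : ℝ, E = ∑ y ∈ box cT (2 * ((L ^ (t + 1) : ℕ) : ℤ)), ∑ ν,
              (if y + unitVec ν ∈ box cT (2 * ((L ^ (t + 1) : ℕ) : ℤ)) then ‖F (y + unitVec ν) - F y‖ ^ 2 else 0) := ⟨_, rfl⟩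
  have hET0 : 0 ≤ ET := by rw [hET]; exact Finset.sum_nonneg fun _ _ => Finset.sum_nonneg fun _ _ => by split_ifs <;> positivity
  -- containments and energies
  have hjt' : 2 * ((L ^ j : ℕ) : ℤ) ≤ 2 * ((L ^ t : ℕ) : ℤ) := by
    have : L ^ j ≤ L ^ t := Nat.pow_le_pow_right (by omega) hjt
    exact_mod_cast Nat.mul_le_mul_left 2 this
  have hsub01 : box ((((L ^ j : ℕ) : ℤ)) • x) (2 * ((L ^ j : ℕ) : ℤ)) ⊆ box cT (2 * ((L ^ (t + 1) : ℕ) : ℤ)) :=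
    (box_subset_box hjt').trans hT
  have hE1 := gradE_mono hsub01 F
  have hE2 := gradE_mono hT F
  set a : ℝ := 5 * N * (L : ℝ) ^ 2 / 32 with ha
  have ha0 : 0 ≤ a := by positivity
  -- step 1: tube vs its own box (part 1 §1)
  have h1 : ‖m0 - m1‖ ^ 2 ≤ 10 * N * ((L : ℝ) ^ j)⁻¹ * ET := by
    have h := normSq_tubeAvg_sub_boxMean_le (N := N) L hL1 (fun y (_ : Fin 3) => F y) j x κ
    beta_reduce at h
    rw [← hm0, ← hm1] at h
    refine h.trans ?_
    have hcoef : (((L ^ j : ℕ) : ℝ) / ((L ^ j : ℕ) : ℝ) ^ 4) * (N * ((((2 * ((L ^ j : ℕ) : ℤ)) : ℤ) : ℝ) * (2 * (((2 * ((L ^ j : ℕ) : ℤ)) : ℤ) : ℝ) + 1)))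
        ≤ 10 * N * ((L : ℝ) ^ j)⁻¹ := by
      have hLj1 : (1 : ℝ) ≤ (L : ℝ) ^ j := one_le_pow₀ (by exact_mod_cast hL1)
      have hb : (2 * (L : ℝ) ^ j) * (2 * (2 * (L : ℝ) ^ j) + 1) ≤ 10 * ((L : ℝ) ^ j) ^ 2 := by nlinarith [hLj1, hLj]
      have e : (((L ^ j : ℕ) : ℝ) / ((L ^ j : ℕ) : ℝ) ^ 4) * (N * ((((2 * ((L ^ j : ℕ) : ℤ)) : ℤ) : ℝ) * (2 * (((2 * ((L ^ j : ℕ) : ℤ)) : ℤ) : ℝ) + 1)))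
          = N * ((L : ℝ) ^ j)⁻¹ * ((2 * (L : ℝ) ^ j) * (2 * (2 * (L : ℝ) ^ j) + 1) / ((L : ℝ) ^ j) ^ 2) := by
        push_cast; field_simp
      rw [e]
      have hN : (0 : ℝ) ≤ N := Nat.cast_nonneg N
      have hq : (2 * (L : ℝ) ^ j) * (2 * (2 * (L : ℝ) ^ j) + 1) / ((L : ℝ) ^ j) ^ 2 ≤ 10 := by
        rw [div_le_iff₀ (by positivity)]; linarith [hb]
      calc (N : ℝ) * ((L : ℝ) ^ j)⁻¹ * ((2 * (L : ℝ) ^ j) * (2 * (2 * (L : ℝ) ^ j) + 1) / ((L : ℝ) ^ j) ^ 2)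
          ≤ (N : ℝ) * ((L : ℝ) ^ j)⁻¹ * 10 := mul_le_mul_of_nonneg_left hq (by positivity)
        _ = 10 * N * ((L : ℝ) ^ j)⁻¹ := by ring
    calc _ ≤ 10 * N * ((L : ℝ) ^ j)⁻¹ * ∑ y ∈ box ((((L ^ j : ℕ) : ℤ)) • x) (2 * ((L ^ j : ℕ) : ℤ)), ∑ ν,
              (if y + unitVec ν ∈ box ((((L ^ j : ℕ) : ℤ)) • x) (2 * ((L ^ j : ℕ) : ℤ)) then ‖F (y + unitVec ν) - F y‖ ^ 2 else 0) :=
          mul_le_mul_of_nonneg_right hcoef (Finset.sum_nonneg fun _ _ => Finset.sum_nonneg fun _ _ => by split_ifs <;> positivity)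
      _ ≤ 10 * N * ((L : ℝ) ^ j)⁻¹ * ET := by rw [hET]; exact mul_le_mul_of_nonneg_left hE1 (by positivity)
  -- step 2: the chain from `2Lʲ` to `2Lᵗ` (part 1 §2)
  have h2 : ‖m1 - m2‖ ≤ Real.sqrt (a * ET) * (((Real.sqrt L)⁻¹) ^ j * (Real.sqrt L / (Real.sqrt L - 1))) := by
    have h := norm_boxMean_chain_le (N := N) L hL1 ((((L ^ j : ℕ) : ℤ)) • x) F j t hjt
    rw [← hm1, ← hm2] at h
    refine h.trans ?_
    refine mul_le_mul (Real.sqrt_le_sqrt (mul_le_mul_of_nonneg_left (by rw [hET]; exact hE2) ha0)) (sum_Ico_sqrt_inv_pow_le L hL j t)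
      (Finset.sum_nonneg fun _ _ => by positivity) (by positivity)
  -- step 3: the cross-centre link `box(Lʲx, 2Lᵗ) ⊆ T` (F1 §2)
  have h3 : ‖m2 - mT‖ ^ 2 ≤ a * ((L : ℝ) ^ t)⁻¹ * ET := by
    have h := normSq_boxMean_sub_boxMean_le (N := N) (z := (((L ^ j : ℕ) : ℤ)) • x) (z' := cT) (R := 2 * ((L ^ t : ℕ) : ℤ))
      (R' := 2 * ((L ^ (t + 1) : ℕ) : ℤ)) (by positivity) (by positivity) hT F
    rw [← hm2, ← hmT, ← hET] at h
    refine h.trans (mul_le_mul_of_nonneg_right ?_ hET0)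
    -- same coefficient algebra as part 1's one-scale step
    have hLt : (0 : ℝ) < (L : ℝ) ^ t := by positivity
    have hcard : ((box ((((L ^ j : ℕ) : ℤ)) • x) (2 * ((L ^ t : ℕ) : ℤ))).card : ℝ) = (4 * (L : ℝ) ^ t + 1) ^ 3 := by
      rw [card_box_eq _ (2 * ((L ^ t : ℕ) : ℤ)) (4 * L ^ t) (by push_cast; ring)]
      push_cast; ring
    rw [hcard]
    have h64 : 64 * ((L : ℝ) ^ t) ^ 3 ≤ (4 * (L : ℝ) ^ t + 1) ^ 3 := by nlinarith [hLt, pow_pos hLt 2, pow_pos hLt 3]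
    have hLt1 : (1 : ℝ) ≤ (L : ℝ) ^ (t + 1) := one_le_pow₀ (by exact_mod_cast hL1)
    have hsq : (L : ℝ) ^ (t + 1) ≤ (L : ℝ) ^ (t + 1) * (L : ℝ) ^ (t + 1) := le_mul_of_one_le_right (by positivity) hLt1
    have hnum : (N : ℝ) * ((((2 * ((L ^ (t + 1) : ℕ) : ℤ) : ℤ) : ℝ)) * (2 * (((2 * ((L ^ (t + 1) : ℕ) : ℤ) : ℤ) : ℝ)) + 1))
        ≤ N * (10 * ((L : ℝ) ^ (t + 1)) ^ 2) := by
      push_cast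
      refine mul_le_mul_of_nonneg_left ?_ (Nat.cast_nonneg N)
      nlinarith [hsq]
    have hpos : (0 : ℝ) < (4 * (L : ℝ) ^ t + 1) ^ 3 := by positivity
    rw [div_le_iff₀ hpos]
    calc (N : ℝ) * ((((2 * ((L ^ (t + 1) : ℕ) : ℤ) : ℤ) : ℝ)) * (2 * (((2 * ((L ^ (t + 1) : ℕ) : ℤ) : ℤ) : ℝ)) + 1))
        ≤ N * (10 * ((L : ℝ) ^ (t + 1)) ^ 2) := hnum
      _ = a * ((L : ℝ) ^ t)⁻¹ * (64 * ((L : ℝ) ^ t) ^ 3) := by rw [ha]; field_simp; ring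
      _ ≤ a * ((L : ℝ) ^ t)⁻¹ * (4 * (L : ℝ) ^ t + 1) ^ 3 := mul_le_mul_of_nonneg_left h64 (by positivity)
  -- squares of the three steps, each `≤ (…)·L^{-j}·ET`
  have hq2 : ‖m1 - m2‖ ^ 2 ≤ a * ET * (((L : ℝ) ^ j)⁻¹ * ((L : ℝ) / (Real.sqrt L - 1) ^ 2)) := by
    have hb : 0 ≤ Real.sqrt (a * ET) * (((Real.sqrt L)⁻¹) ^ j * (Real.sqrt L / (Real.sqrt L - 1))) := by positivity
    have hr : (((Real.sqrt L)⁻¹) ^ j * (Real.sqrt L / (Real.sqrt L - 1))) ^ 2 = ((L : ℝ) ^ j)⁻¹ * ((L : ℝ) / (Real.sqrt L - 1) ^ 2) := by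
      rw [mul_pow, Prop7CornerFrameLegsFlatZd.sqrt_inv_pow_sq, div_pow, Real.sq_sqrt hL0.le]
    have hS : (Real.sqrt (a * ET) * (((Real.sqrt L)⁻¹) ^ j * (Real.sqrt L / (Real.sqrt L - 1)))) ^ 2
        = a * ET * (((L : ℝ) ^ j)⁻¹ * ((L : ℝ) / (Real.sqrt L - 1) ^ 2)) := by
      rw [mul_pow, Real.sq_sqrt (by positivity), hr]
    calc ‖m1 - m2‖ ^ 2 ≤ (Real.sqrt (a * ET) * (((Real.sqrt L)⁻¹) ^ j * (Real.sqrt L / (Real.sqrt L - 1)))) ^ 2 :=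
          pow_le_pow_left₀ (norm_nonneg _) h2 2
      _ = a * ET * (((L : ℝ) ^ j)⁻¹ * ((L : ℝ) / (Real.sqrt L - 1) ^ 2)) := hS
  have hq3 : ‖m2 - mT‖ ^ 2 ≤ a * ((L : ℝ) ^ j)⁻¹ * ET := by
    refine h3.trans (mul_le_mul_of_nonneg_right (mul_le_mul_of_nonneg_left ?_ ha0) hET0)
    exact inv_anti₀ hLj (pow_le_pow_right₀ (by exact_mod_cast hL1) hjt)
  -- triangle
  have htri : ‖m0 - mT‖ ≤ ‖m0 - m1‖ + ‖m1 - m2‖ + ‖m2 - mT‖ := by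
    calc ‖m0 - mT‖ ≤ ‖m0 - m2‖ + ‖m2 - mT‖ := norm_sub_le_norm_sub_add_norm_sub _ _ _
      _ ≤ ‖m0 - m1‖ + ‖m1 - m2‖ + ‖m2 - mT‖ := by linarith [norm_sub_le_norm_sub_add_norm_sub m0 m1 m2]
  have hsq3 : ‖m0 - mT‖ ^ 2 ≤ 3 * (‖m0 - m1‖ ^ 2 + ‖m1 - m2‖ ^ 2 + ‖m2 - mT‖ ^ 2) := by
    have h0 : 0 ≤ ‖m0 - mT‖ := norm_nonneg _
    nlinarith [htri, sq_nonneg (‖m0 - m1‖ - ‖m1 - m2‖), sq_nonneg (‖m1 - m2‖ - ‖m2 - mT‖), sq_nonneg (‖m0 - m1‖ - ‖m2 - mT‖),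
      norm_nonneg (m0 - m1), norm_nonneg (m1 - m2), norm_nonneg (m2 - mT)]
  rw [← hm0, ← hmT, ← hET]
  have e2 : a * ET * (((L : ℝ) ^ j)⁻¹ * ((L : ℝ) / (Real.sqrt L - 1) ^ 2)) = a * ((L : ℝ) ^ j)⁻¹ * ((L : ℝ) / (Real.sqrt L - 1) ^ 2) * ET := by ring
  rw [e2] at hq2
  calc ‖m0 - mT‖ ^ 2 ≤ 3 * (‖m0 - m1‖ ^ 2 + ‖m1 - m2‖ ^ 2 + ‖m2 - mT‖ ^ 2) := hsq3
    _ ≤ 3 * (10 * N * ((L : ℝ) ^ j)⁻¹ * ET + a * ((L : ℝ) ^ j)⁻¹ * ((L : ℝ) / (Real.sqrt L - 1) ^ 2) * ET + a * ((L : ℝ) ^ j)⁻¹ * ET) := by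
        linarith [h1, hq2, hq3]
    _ = (3 * (10 * N + a * ((L : ℝ) / (Real.sqrt L - 1) ^ 2 + 1))) * ((L : ℝ) ^ j)⁻¹ * ET := by ring

/-! ## §3 One level: the tree functional of the difference of the tube field and its translate -/

set_option maxHeartbeats 400000 in
-- HEARTBEAT rule (README): the per-bond step instantiates §2 twice under a double sum; measured > 200k; decl-local.
/-- ★ **ONE LEVEL**: `3 ≤ L`, `j ≤ t`; if every tube box `box(Lʲx, 2Lᵗ)` and `box(Lʲ(x+v), 2Lᵗ)`, `x ∈ box(q, 3L)`, sits in the top box `T = box(c_T, 2L^{t+1})`, then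
`‖F̂(Q_jA)(q) − F̂(Q_jA)(q+v)‖² ≤ 9L²·(6L+1)³·4·C₁·Lʲ · Σ_κ GradE_{A(·,κ)}(T)`. [cite: Balaban1985Averaging, (110)–(112) p.34, (125)–(127) pp.36–37] -/
theorem normSq_Fhat_linQIter_sub_le [NeZero N] (L : ℕ) (hL : 3 ≤ L) (A : Zd 3 → Fin 3 → Matrix (Fin N) (Fin N) ℂ) (j t : ℕ) (hjt : j ≤ t)
    (q v cT : Zd 3)
    (hT₁ : ∀ x ∈ box q (((3 * L : ℕ) : ℤ)), box ((((L ^ j : ℕ) : ℤ)) • x) (2 * ((L ^ t : ℕ) : ℤ)) ⊆ box cT (2 * ((L ^ (t + 1) : ℕ) : ℤ)))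
    (hT₂ : ∀ x ∈ box q (((3 * L : ℕ) : ℤ)), box ((((L ^ j : ℕ) : ℤ)) • (x + v)) (2 * ((L ^ t : ℕ) : ℤ)) ⊆ box cT (2 * ((L ^ (t + 1) : ℕ) : ℤ))) :
    ‖Fhat L (linQIter L A j) q - Fhat L (linQIter L A j) (q + v)‖ ^ 2
      ≤ (9 * (L : ℝ) ^ 2 * (6 * (L : ℝ) + 1) ^ 3 * 4 * (3 * (10 * N + (5 * N * (L : ℝ) ^ 2 / 32) * ((L : ℝ) / (Real.sqrt L - 1) ^ 2 + 1))))
          * (L : ℝ) ^ j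
          * ∑ κ : Fin 3, ∑ y ∈ box cT (2 * ((L ^ (t + 1) : ℕ) : ℤ)), ∑ ν,
              (if y + unitVec ν ∈ box cT (2 * ((L ^ (t + 1) : ℕ) : ℤ)) then ‖A (y + unitVec ν) κ - A y κ‖ ^ 2 else 0) := by
  have hL1 : 1 ≤ L := by omega
  have hL0 : (0 : ℝ) < L := by exact_mod_cast (by omega : 0 < L)
  have hLj : (0 : ℝ) < (L : ℝ) ^ j := by positivity
  set B : Zd 3 → Fin 3 → Matrix (Fin N) (Fin N) ℂ := linQIter L A j with hB
  set C₁ : ℝ := 3 * (10 * N + (5 * N * (L : ℝ) ^ 2 / 32) * ((L : ℝ) / (Real.sqrt L - 1) ^ 2 + 1)) with hC₁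
  set ET : Fin 3 → ℝ := fun κ => ∑ y ∈ box cT (2 * ((L ^ (t + 1) : ℕ) : ℤ)), ∑ ν,
              (if y + unitVec ν ∈ box cT (2 * ((L ^ (t + 1) : ℕ) : ℤ)) then ‖A (y + unitVec ν) κ - A y κ‖ ^ 2 else 0) with hET
  have hET0 : ∀ κ, 0 ≤ ET κ := fun κ => Finset.sum_nonneg fun _ _ => Finset.sum_nonneg fun _ _ => by split_ifs <;> positivity
  have hC₁0 : 0 ≤ C₁ := by
    have : 0 < Real.sqrt L - 1 := by
      have : (1 : ℝ) < Real.sqrt L := by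
        rw [show (1 : ℝ) = Real.sqrt 1 by simp]; exact Real.sqrt_lt_sqrt (by norm_num) (by exact_mod_cast (by omega : 1 < L))
      linarith
    positivity
  -- `F̂(B)(q) − F̂(B)(q+v) = F̂(B − B∘τ_v)(q)` and F1's box bound
  have hdiff : Fhat L B q - Fhat L B (q + v) = Fhat L (B - fun y κ => B (y + v) κ) q := by
    rw [← Fhat_translate L B v q, Fhat_sub]
  rw [hdiff]
  have hF := normSq_Fhat_le (N := N) (d := 3) L hL1 (B - fun y κ => B (y + v) κ) q
  refine hF.trans ?_
  -- per bond
  have hbond : ∀ x ∈ box q (((3 * L : ℕ) : ℤ)), ∀ κ : Fin 3,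
      ‖(B - fun y κ => B (y + v) κ) x κ‖ ^ 2 ≤ 4 * C₁ * (L : ℝ) ^ j * ET κ := by
    intro x hx κ
    have h1 := normSq_tubeAvg_sub_topMean_le (N := N) L hL (fun y => A y κ) j t hjt x cT κ (hT₁ x hx)
    have h2 := normSq_tubeAvg_sub_topMean_le (N := N) L hL (fun y => A y κ) j t hjt (x + v) cT κ (hT₂ x hx)
    beta_reduce at h1 h2
    rw [← hC₁] at h1 h2
    change ‖_‖ ^ 2 ≤ C₁ * ((L : ℝ) ^ j)⁻¹ * ET κ at h1
    change ‖_‖ ^ 2 ≤ C₁ * ((L : ℝ) ^ j)⁻¹ * ET κ at h2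
    -- the two tube values
    have e1 : (B - fun y κ => B (y + v) κ) x κ = B x κ - B (x + v) κ := rfl
    rw [e1, hB, linQIter_eq_smul_avg L hL1 A j x κ, linQIter_eq_smul_avg L hL1 A j (x + v) κ, ← smul_sub]
    set m0 := ((Fintype.card ((Fin 3 → Fin (L ^ j)) × Fin (L ^ j)) : ℝ)⁻¹)
          • ∑ σ : (Fin 3 → Fin (L ^ j)) × Fin (L ^ j), A ((((L ^ j : ℕ) : ℤ)) • x + boxVec (L ^ j) σ.1 + ((σ.2 : ℕ) : ℤ) • e κ) κ with hm0
    set m0' := ((Fintype.card ((Fin 3 → Fin (L ^ j)) × Fin (L ^ j)) : ℝ)⁻¹)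
          • ∑ σ : (Fin 3 → Fin (L ^ j)) × Fin (L ^ j), A ((((L ^ j : ℕ) : ℤ)) • (x + v) + boxVec (L ^ j) σ.1 + ((σ.2 : ℕ) : ℤ) • e κ) κ with hm0'
    set mT := ((((box cT (2 * ((L ^ (t + 1) : ℕ) : ℤ))).card : ℝ) : ℂ))⁻¹ • ∑ y ∈ box cT (2 * ((L ^ (t + 1) : ℕ) : ℤ)), A y κ with hmT
    rw [norm_smul, mul_pow, Real.norm_eq_abs, abs_of_pos hLj]
    have htri : ‖m0 - m0'‖ ≤ ‖m0 - mT‖ + ‖m0' - mT‖ := by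
      calc ‖m0 - m0'‖ ≤ ‖m0 - mT‖ + ‖mT - m0'‖ := norm_sub_le_norm_sub_add_norm_sub _ _ _
        _ = ‖m0 - mT‖ + ‖m0' - mT‖ := by rw [norm_sub_rev mT m0']
    have hsq : ‖m0 - m0'‖ ^ 2 ≤ 2 * (‖m0 - mT‖ ^ 2 + ‖m0' - mT‖ ^ 2) := by
      nlinarith [htri, sq_nonneg (‖m0 - mT‖ - ‖m0' - mT‖), norm_nonneg (m0 - m0'), norm_nonneg (m0 - mT), norm_nonneg (m0' - mT)]
    have hLL : ((L : ℝ) ^ j) ^ 2 * (C₁ * ((L : ℝ) ^ j)⁻¹ * ET κ) = C₁ * (L : ℝ) ^ j * ET κ := by field_simp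
    nlinarith [hsq, h1, h2, hLL, pow_pos hLj 2]
  -- sum over the box and the directions
  have hcard : ((box q (((3 * L : ℕ) : ℤ))).card : ℝ) = (6 * (L : ℝ) + 1) ^ 3 := by
    rw [card_box_eq q (((3 * L : ℕ) : ℤ)) (6 * L) (by push_cast; ring)]; push_cast; ring
  have hsum : ∑ x ∈ box q (((3 * L : ℕ) : ℤ)), ∑ κ : Fin 3, ‖(B - fun y κ => B (y + v) κ) x κ‖ ^ 2
      ≤ ((box q (((3 * L : ℕ) : ℤ))).card : ℝ) * (4 * C₁ * (L : ℝ) ^ j * ∑ κ : Fin 3, ET κ) := by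
    rw [← nsmul_eq_mul, ← Finset.sum_const]
    refine Finset.sum_le_sum fun x hx => ?_
    rw [Finset.mul_sum]
    exact Finset.sum_le_sum fun κ _ => hbond x hx κ
  rw [hcard] at hsum
  calc ((3 : ℕ) * L : ℝ) ^ 2 * ∑ x ∈ box q (((3 * L : ℕ) : ℤ)), ∑ κ : Fin 3, ‖(B - fun y κ => B (y + v) κ) x κ‖ ^ 2
      ≤ ((3 : ℕ) * L : ℝ) ^ 2 * ((6 * (L : ℝ) + 1) ^ 3 * (4 * C₁ * (L : ℝ) ^ j * ∑ κ : Fin 3, ET κ)) :=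
        mul_le_mul_of_nonneg_left hsum (by positivity)
    _ = (9 * (L : ℝ) ^ 2 * (6 * (L : ℝ) + 1) ^ 3 * 4 * C₁) * (L : ℝ) ^ j * ∑ κ : Fin 3, ET κ := by push_cast; ring
    _ = _ := by rw [hC₁]

/-! ## §4 The level sum at a block corner: dyadic weights, top level dominates -/

/-- the containment of the level-`j` tube boxes near the corner `L^{k−j}y` in the top box `box(Lᵏy, 2L^{k+2})` (shift `s ∈ {0, L^{k−j}e_μ}` allowed through `|s|_∞ ≤ L^{k−j}`).
[folklore] -/
theorem tubeBox_subset_top (L : ℕ) (hL : 3 ≤ L) {j k : ℕ} (hjk : j < k) (y q x s : Zd 3)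
    (hq : q = (((L ^ (k - j) : ℕ) : ℤ)) • y) (hx : x ∈ box q (((3 * L : ℕ) : ℤ))) (hs : ∀ i, |s i| ≤ ((L ^ (k - j) : ℕ) : ℤ)) :
    box ((((L ^ j : ℕ) : ℤ)) • (x + s)) (2 * ((L ^ (k + 1) : ℕ) : ℤ)) ⊆ box ((((L ^ k : ℕ) : ℤ)) • y) (2 * ((L ^ (k + 2) : ℕ) : ℤ)) := by
  refine box_subset_box_of fun i => ?_
  rw [mem_box] at hx
  have hxi := hx i
  have hsi := hs i
  subst hq
  have e0 : ((((L ^ j : ℕ) : ℤ)) • (x + s)) i - ((((L ^ k : ℕ) : ℤ)) • y) i = ((L ^ j : ℕ) : ℤ) * (x i + s i) - ((L ^ k : ℕ) : ℤ) * y i := by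
    simp only [Pi.smul_apply, smul_eq_mul, Pi.add_apply]
  rw [e0]
  simp only [Pi.smul_apply, smul_eq_mul] at hxi
  have hkj : L ^ j * L ^ (k - j) = L ^ k := by rw [← pow_add, Nat.add_sub_cancel' hjk.le]
  have hLj0 : (0 : ℤ) ≤ ((L ^ j : ℕ) : ℤ) := by positivity
  have hjk' : ((L ^ j : ℕ) : ℤ) * ((L ^ (k - j) : ℕ) : ℤ) = ((L ^ k : ℕ) : ℤ) := by exact_mod_cast hkj
  -- `|Lʲ(x+s) − Lᵏy| ≤ Lʲ(|x − L^{k-j}y| + |s|) ≤ Lʲ(3L + L^{k-j}) ≤ 3L^{j+1} + Lᵏ ≤ 4Lᵏ`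
  have h1 : |((L ^ j : ℕ) : ℤ) * (x i + s i) - ((L ^ k : ℕ) : ℤ) * y i|
      ≤ ((L ^ j : ℕ) : ℤ) * (((3 * L : ℕ) : ℤ)) + ((L ^ k : ℕ) : ℤ) := by
    have e : ((L ^ j : ℕ) : ℤ) * (x i + s i) - ((L ^ k : ℕ) : ℤ) * y i
        = ((L ^ j : ℕ) : ℤ) * (x i - ((L ^ (k - j) : ℕ) : ℤ) * y i) + ((L ^ j : ℕ) : ℤ) * s i := by rw [← hjk']; ring
    rw [e]
    refine (abs_add_le _ _).trans ?_
    rw [abs_mul, abs_of_nonneg hLj0, abs_mul, abs_of_nonneg hLj0]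
    have := mul_le_mul_of_nonneg_left hxi hLj0
    have := mul_le_mul_of_nonneg_left hsi hLj0
    nlinarith
  have hj1k : L ^ j * (3 * L) ≤ 3 * L ^ k := by
    have : L ^ (j + 1) ≤ L ^ k := Nat.pow_le_pow_right (by omega) hjk
    rw [pow_succ] at this; nlinarith
  have hj1k' : ((L ^ j : ℕ) : ℤ) * (((3 * L : ℕ) : ℤ)) ≤ 3 * ((L ^ k : ℕ) : ℤ) := by exact_mod_cast hj1k
  have htop : 4 * ((L ^ k : ℕ) : ℤ) + 2 * ((L ^ (k + 1) : ℕ) : ℤ) ≤ 2 * ((L ^ (k + 2) : ℕ) : ℤ) := by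
    have h3 : (3 : ℤ) ≤ L := by exact_mod_cast hL
    have hk0 : (0 : ℤ) ≤ (L : ℤ) ^ k := by positivity
    have hpoly : (0 : ℤ) ≤ 2 * (L : ℤ) ^ 2 - 2 * L - 4 := by nlinarith [h3]
    have hm := mul_nonneg hk0 hpoly
    push_cast
    have e1 : (L : ℤ) ^ (k + 1) = L * L ^ k := by ring
    have e2 : (L : ℤ) ^ (k + 2) = L ^ 2 * L ^ k := by ring
    rw [e1, e2]
    nlinarith [hm]
  linarith

set_option maxHeartbeats 400000 in
-- HEARTBEAT rule (README): the level sum instantiates §3 under `Finset.range k`; measured > 200k; decl-local.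
/-- ★★ **THE FLAT CORNER-FRAME LEGS ON `ℤ³`, K-UNIFORM**: `3 ≤ L`, any `A : ℤ³ → Fin 3 → M_N`, block corner `y`, direction `μ`:
`‖Σ_{j<k} [F̂(Q_jA)(L^{k−j}y) − F̂(Q_jA)(L^{k−j}(y + e_μ))]‖² ≤ 2·C₂(L,N)·Lᵏ∕(L−2) · Σ_κ GradE_{A(·,κ)}(box(Lᵏy, 2L^{k+2}))`,
`C₂ = 9L²(6L+1)³·4·C₁` — the level-`j` term costs `O(Lʲ)` (§3 at `t = k+1`), and the dyadic level sum is dominated by the top (★px6).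
[cite: Balaban1985Averaging, (110)–(112) p.34, (125)–(127) pp.36–37, (160) p.42; Giaquinta1984, Ch. III §1] -/
theorem normSq_cornerFrameLegs_flat_Zd [NeZero N] (L : ℕ) (hL : 3 ≤ L) (A : Zd 3 → Fin 3 → Matrix (Fin N) (Fin N) ℂ) (k : ℕ) (y : Zd 3) (μ : Fin 3) :
    ‖∑ j ∈ Finset.range k, (Fhat L (linQIter L A j) ((((L ^ (k - j) : ℕ) : ℤ)) • y)
        - Fhat L (linQIter L A j) ((((L ^ (k - j) : ℕ) : ℤ)) • (y + e μ)))‖ ^ 2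
      ≤ 2 * (9 * (L : ℝ) ^ 2 * (6 * (L : ℝ) + 1) ^ 3 * 4 * (3 * (10 * N + (5 * N * (L : ℝ) ^ 2 / 32) * ((L : ℝ) / (Real.sqrt L - 1) ^ 2 + 1))))
          * ((L : ℝ) ^ k / ((L : ℝ) - 2))
          * ∑ κ : Fin 3, ∑ z ∈ box ((((L ^ k : ℕ) : ℤ)) • y) (2 * ((L ^ (k + 2) : ℕ) : ℤ)), ∑ ν,
              (if z + unitVec ν ∈ box ((((L ^ k : ℕ) : ℤ)) • y) (2 * ((L ^ (k + 2) : ℕ) : ℤ)) then ‖A (z + unitVec ν) κ - A z κ‖ ^ 2 else 0) := by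
  set C₂ : ℝ := 9 * (L : ℝ) ^ 2 * (6 * (L : ℝ) + 1) ^ 3 * 4 * (3 * (10 * N + (5 * N * (L : ℝ) ^ 2 / 32) * ((L : ℝ) / (Real.sqrt L - 1) ^ 2 + 1))) with hC₂
  set E : ℝ := ∑ κ : Fin 3, ∑ z ∈ box ((((L ^ k : ℕ) : ℤ)) • y) (2 * ((L ^ (k + 2) : ℕ) : ℤ)), ∑ ν,
              (if z + unitVec ν ∈ box ((((L ^ k : ℕ) : ℤ)) • y) (2 * ((L ^ (k + 2) : ℕ) : ℤ)) then ‖A (z + unitVec ν) κ - A z κ‖ ^ 2 else 0) with hE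
  have hL3 : (3 : ℝ) ≤ L := by exact_mod_cast hL
  have hE0 : 0 ≤ E := Finset.sum_nonneg fun _ _ => Finset.sum_nonneg fun _ _ => Finset.sum_nonneg fun _ _ => by split_ifs <;> positivity
  have hC₂0 : 0 ≤ C₂ := by
    have : 0 < Real.sqrt L - 1 := by
      have : (1 : ℝ) < Real.sqrt L := by
        rw [show (1 : ℝ) = Real.sqrt 1 by simp]; exact Real.sqrt_lt_sqrt (by norm_num) (by linarith)
      linarith
    positivity
  -- per level (§3 at `t = k + 1`, `c_T = Lᵏy`)
  have hlev : ∀ j ∈ Finset.range k,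
      ‖Fhat L (linQIter L A j) ((((L ^ (k - j) : ℕ) : ℤ)) • y) - Fhat L (linQIter L A j) ((((L ^ (k - j) : ℕ) : ℤ)) • (y + e μ))‖ ^ 2
        ≤ C₂ * (L : ℝ) ^ j * E := by
    intro j hj
    rw [Finset.mem_range] at hj
    rw [smul_add]
    have hs : ∀ i, |((((L ^ (k - j) : ℕ) : ℤ)) • e μ) i| ≤ ((L ^ (k - j) : ℕ) : ℤ) := by
      intro i
      simp only [Pi.smul_apply, smul_eq_mul, e, Pi.single_apply]
      split_ifs <;> simp
    exact normSq_Fhat_linQIter_sub_le (N := N) L hL A j (k + 1) (by omega) _ _ _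
      (fun x hx => by simpa using tubeBox_subset_top L hL hj y _ x 0 rfl hx (fun i => by simp))
      (fun x hx => tubeBox_subset_top L hL hj y _ x _ rfl hx hs)
  -- dyadic level sum
  have h1 := norm_sq_sum_range_le_two_mul_dyadic k (fun j => Fhat L (linQIter L A j) ((((L ^ (k - j) : ℕ) : ℤ)) • y)
        - Fhat L (linQIter L A j) ((((L ^ (k - j) : ℕ) : ℤ)) • (y + e μ)))
  refine h1.trans ?_
  have h2 : ∑ j ∈ Finset.range k, (2 : ℝ) ^ (k - 1) * (1 / 2) ^ j
        * ‖Fhat L (linQIter L A j) ((((L ^ (k - j) : ℕ) : ℤ)) • y) - Fhat L (linQIter L A j) ((((L ^ (k - j) : ℕ) : ℤ)) • (y + e μ))‖ ^ 2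
      ≤ ∑ j ∈ Finset.range k, (2 : ℝ) ^ (k - 1) * (1 / 2) ^ j * (L : ℝ) ^ j * (C₂ * E) := by
    refine Finset.sum_le_sum fun j hj => ?_
    have := mul_le_mul_of_nonneg_left (hlev j hj) (by positivity : (0 : ℝ) ≤ (2 : ℝ) ^ (k - 1) * (1 / 2) ^ j)
    calc _ ≤ (2 : ℝ) ^ (k - 1) * (1 / 2) ^ j * (C₂ * (L : ℝ) ^ j * E) := this
      _ = _ := by ring
  rw [← Finset.sum_mul] at h2
  have h3 := dyadic_level_sum_le hL3 k
  have hL2 : (0 : ℝ) < (L : ℝ) - 2 := by linarith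
  calc 2 * ∑ j ∈ Finset.range k, (2 : ℝ) ^ (k - 1) * (1 / 2) ^ j
          * ‖Fhat L (linQIter L A j) ((((L ^ (k - j) : ℕ) : ℤ)) • y) - Fhat L (linQIter L A j) ((((L ^ (k - j) : ℕ) : ℤ)) • (y + e μ))‖ ^ 2
      ≤ 2 * ((∑ j ∈ Finset.range k, (2 : ℝ) ^ (k - 1) * (1 / 2) ^ j * (L : ℝ) ^ j) * (C₂ * E)) := by linarith [h2]
    _ ≤ 2 * (((L : ℝ) ^ k / ((L : ℝ) - 2)) * (C₂ * E)) := by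
        have := mul_le_mul_of_nonneg_right h3 (by positivity : 0 ≤ C₂ * E)
        linarith
    _ = 2 * C₂ * ((L : ℝ) ^ k / ((L : ℝ) - 2)) * E := by ring

end Summit.QuantumFields.YangMills.Theorems.Prop7CornerFrameLegsFlatZdLevels

end
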